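import Mathlib
import HarnessLib
import Literature.MathematicalPhysics.QuantumManyBody.PeriodicTorusCalculus
import Summits.AtomisticToContinuum.BoseEinsteinCondensation.Theorems.BECNewtonPolicyIterationPolicyImprovementIdentityGroundState

/-!
# Route `BECNewtonPolicyIteration` — support item `PolicyImprovementIdentity`
# (stmt-AtomisticToContinuum-9319), part 2/5: the Rayleigh quotient of `e^{-S}` and Barta's
# inequality on the torus

Helper file (`--supports stmt-AtomisticToContinuum-9319`), sequel of part 1/5
(`…PolicyImprovementIdentityGroundState.lean`). Setting: `L > 0`, a measurable profile `v` with
bounded periodic interaction `W = ∑_{i<j} v^per ≤ Cw < ∞` (its real form and integrability are reused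
from `Theorems.ImuWeakEulerLagrange`), `S : (ℝ³)^N → ℝ` of class `C²` and `Lℤ³`-periodic in every
particle, `F = e^{-S} > 0`, local energy `E_loc = (-ΔF + WF)/F = ΔS - |∇S|² + W = localKinetic S + W`
and mean `Ē = ⟨E_loc⟩_F = ∫_{cell} E_loc F² / ∫_{cell} F² = weightedMean L F E_loc`
(`LangevinGenerator.lean`).

* `integral_kineticDensityReal_exp_neg` — `∫_{cell} |∇e^{-S}|² = ∫_{cell} (ΔS - |∇S|²) e^{-2S}`
  (part 1/5 with `Φ = e^{-S}`, whose covariant derivative vanishes: "one integration by parts").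
* `periodicEnergy_eq_weightedMean` — **Rayleigh quotient = mean local energy**: every periodic trial
  state proportional to `e^{-S}` has `periodicEnergy v Ψ = ofReal Ē`; `exists_trialState_exp_neg`:
  the normalised `e^{-S}` is admissible when `S` is Bose symmetric; hence
  `periodicGroundStateEnergy_le_weightedMean`: `E₀^per(N, L) ≤ Ē`.
* `ofReal_le_periodicGroundStateEnergy(_ae)` — **Barta's inequality on the torus**: if `m ≤ E_loc` on
  (a.e. on) the fundamental cell then `m ≤ E₀^per(N, L)`; `periodicGroundStateEnergy_eq_of_localEnergy_eq`: a
  positive periodic solution of `(-Δ + W)F = EF` has `E = E₀^per` (no Perron–Frobenius needed for the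
  energy identity).

References: R. A. Howard, *Dynamic Programming and Markov Processes* (1960) (policy improvement);
M. L. Puterman, S. L. Brumelle, Math. Oper. Res. 4 (1979) 60 (policy iteration = Newton–Kantorovich);
C. J. Holland, CPAM 31 (1978) 509 (logarithmic transform; min–max for the principal eigenvalue);
J. Barta, C. R. Acad. Sci. Paris 204 (1937) 472 (Barta's inequality `inf (Hφ)/φ ≤ E₀`, `φ > 0`);
W. Thirring, *Quantum Mathematical Physics*, §3.5; [ReedSimonIV1978] §XIII.12; [BakryGentilLedoux2014]
§1.11.3 (`Γ`-calculus, Green's identity); [KipnisLandim1999] App. 1 §6 (weak Poisson equation);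
[Fournais2020] (1.1)–(1.2) (the periodic problem).
-/

noncomputable section

open MeasureTheory Filter Set
open scoped ENNReal NNReal Topology InnerProductSpace ComplexConjugate BigOperators

namespace Summit.AtomisticToContinuum.BoseEinsteinCondensation.Theorems

open Literature.MathematicalPhysics.QuantumManyBody.BoseGas

namespace PolicyImprovement

open ImuWeakEulerLagrange (integrableOn_toReal_interaction_mul periodicForm_eq_ofReal
  lintegral_nnnorm_sq_eq_ofReal)

variable {N : ℕ} {L : ℝ} {v : ℝ → ℝ≥0∞} {Cw : ℝ≥0∞}

/-- The coordinate unit vector `e_{i,a}` of `(ℝ³)^N` (particle `i`, axis `a`), local notation. -/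
local notation3 "𝐞[" i ", " a "]" => (Pi.single i (EuclideanSpace.single a (1 : ℝ)) : Config _)

/-! ### The positive trial function `e^{-S}` -/

section ExpNeg

variable {S : Config N → ℝ}

/-- The directional derivatives of `e^{-S}` viewed in `ℂ`: `∂_{i,a} e^{-S} = -(∂_{i,a}S) e^{-S}`.
[folklore] -/
theorem fderiv_ofReal_exp_neg_apply (hS : Differentiable ℝ S) (X : Config N) (i : Fin N) (a : Fin 3) :
    fderiv ℝ (fun Y => ((Real.exp (-S Y) : ℝ) : ℂ)) X 𝐞[i, a] =
      -((((Real.exp (-S X) : ℝ) : ℂ)) * (pderiv i a S X : ℂ)) := by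
  have hF : DifferentiableAt ℝ (fun Y => Real.exp (-S Y)) X := (hS X).fun_neg.exp
  rw [fderiv_ofReal_apply hF, ← pderiv, pderiv_exp_neg (hS X)]
  push_cast
  ring

/-- For `Φ = e^{-S}` the covariant derivative `∂Φ + Φ ∂S` vanishes identically. [folklore] -/
theorem covDeriv_exp_neg_eq_zero (hS : Differentiable ℝ S) (X : Config N) (i : Fin N) (a : Fin 3) :
    fderiv ℝ (fun Y => ((Real.exp (-S Y) : ℝ) : ℂ)) X 𝐞[i, a] +
      ((Real.exp (-S X) : ℝ) : ℂ) * (pderiv i a S X : ℂ) = 0 := by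
  rw [fderiv_ofReal_exp_neg_apply hS]
  ring

/-- `‖(e^{-S(X)} : ℂ)‖² = (e^{-S(X)})²`. [folklore] -/
theorem norm_ofReal_exp_neg_sq (S : Config N → ℝ) (X : Config N) :
    ‖(((Real.exp (-S X) : ℝ) : ℂ))‖ ^ 2 = Real.exp (-S X) ^ 2 := by
  rw [Complex.norm_real, Real.norm_of_nonneg (Real.exp_pos _).le]

/-- `e^{-S}` viewed in `ℂ` is `Cⁿ` when `S` is. [folklore] -/
theorem contDiff_ofReal_exp_neg {n : WithTop ℕ∞} (hS : ContDiff ℝ n S) :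
    ContDiff ℝ n (fun Y => ((Real.exp (-S Y) : ℝ) : ℂ)) :=
  contDiff_ofReal_comp hS.neg.exp

/-- `e^{-S}` viewed in `ℂ` is lattice periodic when `S` is. [folklore] -/
theorem isTorusPeriodic_ofReal_exp_neg (hSper : IsLatticePeriodic L S) :
    IsTorusPeriodic L (fun Y => ((Real.exp (-S Y) : ℝ) : ℂ)) := fun X i k => by
  simp only [hSper X i k]

/-- **The kinetic energy of `e^{-S}` is its local kinetic energy integrated against `e^{-2S}`**:
`∫_{cell} |∇e^{-S}|² = ∫_{cell} (ΔS - |∇S|²) e^{-2S}` for `S ∈ C²` lattice periodic (one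
integration by parts on the torus: the ground-state representation with `Φ = e^{-S}`, whose
covariant derivative vanishes). [folklore] -/
theorem integral_kineticDensityReal_exp_neg (hL : 0 < L) (hS : ContDiff ℝ 2 S)
    (hSper : IsLatticePeriodic L S) :
    ∫ X in cellN N L, kineticDensityReal (fun Y => ((Real.exp (-S Y) : ℝ) : ℂ)) X =
      ∫ X in cellN N L, localKinetic S X * Real.exp (-S X) ^ 2 := by
  have hSd : Differentiable ℝ S := hS.differentiable two_ne_zero
  have h := integral_sum_norm_sq_covDeriv hL hS hSper (contDiff_ofReal_exp_neg (hS.of_le (by norm_num)))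
    (isTorusPeriodic_ofReal_exp_neg hSper)
  simp only [covDeriv_exp_neg_eq_zero hSd, norm_zero, zero_pow two_ne_zero,
    Finset.sum_const_zero, integral_zero, norm_ofReal_exp_neg_sq] at h
  linarith

/-- `∫_{cell} e^{-2S} > 0` for a continuous `S` on a cell of positive side. [folklore] -/
theorem integral_exp_neg_sq_pos (hL : 0 < L) (hS : Continuous S) :
    0 < ∫ X in cellN N L, Real.exp (-S X) ^ 2 :=
  integral_sq_pos hL (hS.neg.rexp) fun _ => (Real.exp_pos _).ne'

/-- The kinetic density of a constant multiple: `|∇(cΦ)|² = ‖c‖² |∇Φ|²`. [folklore] -/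
theorem kineticDensityReal_const_mul {Φ : Config N → ℂ} {X : Config N} (hΦ : DifferentiableAt ℝ Φ X)
    (c : ℂ) : kineticDensityReal (fun Y => c * Φ Y) X = ‖c‖ ^ 2 * kineticDensityReal Φ X := by
  simp only [kineticDensityReal, fderiv_const_mul_apply' hΦ, norm_mul, mul_pow, Finset.mul_sum]

/-- **The Rayleigh quotient of `e^{-S}` is the mean local energy.** Under a bounded interaction
`W = ∑_{i<j} v^per`, every periodic trial state proportional to `e^{-S}` (`S ∈ C²` lattice
periodic) has energy
`⟨Ψ, HΨ⟩ = ⟨E_loc⟩_{e^{-S}} = ∫ (ΔS - |∇S|² + W) e^{-2S} / ∫ e^{-2S}`, `E_loc = (-ΔF + WF)/F` for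
`F = e^{-S}` (`integral_kineticDensityReal_exp_neg` plus the normalisation `‖c‖² ∫e^{-2S} = 1`).
[folklore] -/
theorem periodicEnergy_eq_weightedMean (hL : 0 < L) (hvm : Measurable v) (hCw : Cw ≠ ⊤)
    (hW : ∀ X : Config N, periodicInteraction v L X ≤ Cw) (hS : ContDiff ℝ 2 S)
    (hSper : IsLatticePeriodic L S) (Ψ : PeriodicTrialState N L) (c : ℂ)
    (hΨ : ∀ X, Ψ.ψ X = c * ((Real.exp (-S X) : ℝ) : ℂ)) :
    periodicEnergy v Ψ = ENNReal.ofReal (weightedMean L (fun X => Real.exp (-S X))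
      (fun X => localKinetic S X + (periodicInteraction v L X).toReal)) := by
  have hS1 : ContDiff ℝ 1 S := hS.of_le (by norm_num)
  have hSd : Differentiable ℝ S := hS1.differentiable one_ne_zero
  have hFc : ContDiff ℝ 1 (fun Y => ((Real.exp (-S Y) : ℝ) : ℂ)) := contDiff_ofReal_exp_neg hS1
  have hFd : Differentiable ℝ (fun Y => ((Real.exp (-S Y) : ℝ) : ℂ)) := hFc.differentiable one_ne_zero
  have hψ : Ψ.ψ = fun Y => c * ((Real.exp (-S Y) : ℝ) : ℂ) := funext hΨ
  -- the integrands in terms of `F = e^{-S}`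
  have hkin : ∀ X, kineticDensityReal Ψ.ψ X =
      ‖c‖ ^ 2 * kineticDensityReal (fun Y => ((Real.exp (-S Y) : ℝ) : ℂ)) X := fun X => by
    rw [hψ, kineticDensityReal_const_mul (hFd X)]
  have hmass : ∀ X, ‖Ψ.ψ X‖ ^ 2 = ‖c‖ ^ 2 * Real.exp (-S X) ^ 2 := fun X => by
    rw [hΨ X, norm_mul, mul_pow, norm_ofReal_exp_neg_sq]
  -- normalisation: `‖c‖² ∫ e^{-2S} = 1`
  set Z : ℝ := ∫ X in cellN N L, Real.exp (-S X) ^ 2 with hZ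
  have hZpos : 0 < Z := integral_exp_neg_sq_pos hL hS.continuous
  have hmass1 : ∫ X in cellN N L, ‖Ψ.ψ X‖ ^ 2 = 1 := by
    have h := Ψ.norm_eq
    rw [lintegral_nnnorm_sq_eq_ofReal Ψ.contDiff.continuous] at h
    have h2 := ENNReal.toReal_ofReal (integral_nonneg fun X => sq_nonneg ‖Ψ.ψ X‖ :
      0 ≤ ∫ X in cellN N L, ‖Ψ.ψ X‖ ^ 2)
    rw [h, ENNReal.toReal_one] at h2
    exact h2.symm
  have hnorm : ‖c‖ ^ 2 * Z = 1 := by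
    rw [← hmass1, hZ, ← integral_const_mul]
    exact integral_congr_ae (Eventually.of_forall fun X => (hmass X).symm)
  -- the energy integral
  have hexpc : Continuous fun X : Config N => Real.exp (-S X) ^ 2 := (hS.continuous.neg.rexp).pow 2
  have hi1 : IntegrableOn (fun X => kineticDensityReal (fun Y => ((Real.exp (-S Y) : ℝ) : ℂ)) X)
      (cellN N L) volume := integrableOn_cellN (continuous_kineticDensityReal hFc) L
  have hi2 : IntegrableOn (fun X => (periodicInteraction v L X).toReal * Real.exp (-S X) ^ 2)
      (cellN N L) volume := integrableOn_toReal_interaction_mul hvm hCw hW hexpc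
  have hi3 : IntegrableOn (fun X => localKinetic S X * Real.exp (-S X) ^ 2) (cellN N L) volume :=
    integrableOn_cellN ((((continuous_finsetSum _ fun i _ => continuous_finsetSum _ fun a _ =>
      continuous_pderiv (contDiff_one_pderiv hS i a) i a)).sub (continuous_gradDot hS1 hS1)).mul hexpc) L
  have hE : ∫ X in cellN N L, (kineticDensityReal Ψ.ψ X + (periodicInteraction v L X).toReal * ‖Ψ.ψ X‖ ^ 2) =
      ‖c‖ ^ 2 * ∫ X in cellN N L, (localKinetic S X + (periodicInteraction v L X).toReal) *
        Real.exp (-S X) ^ 2 := by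
    have hpt : ∀ X, kineticDensityReal Ψ.ψ X + (periodicInteraction v L X).toReal * ‖Ψ.ψ X‖ ^ 2 =
        ‖c‖ ^ 2 * (kineticDensityReal (fun Y => ((Real.exp (-S Y) : ℝ) : ℂ)) X +
          (periodicInteraction v L X).toReal * Real.exp (-S X) ^ 2) := fun X => by
      rw [hkin X, hmass X]; ring
    simp_rw [hpt]
    rw [integral_const_mul, integral_add hi1 hi2, integral_kineticDensityReal_exp_neg hL hS hSper,
      ← integral_add hi3 hi2]
    congr 1
    exact integral_congr_ae (Eventually.of_forall fun X => by ring)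
  rw [periodicEnergy, periodicForm_eq_ofReal hvm hCw hW Ψ.contDiff, hE, weightedMean]
  congr 1
  have hc2 : ‖c‖ ^ 2 = Z⁻¹ := by
    field_simp
    linarith [hnorm]
  rw [hc2, div_eq_inv_mul, hZ]

/-- **The normalised `e^{-S}` is an admissible periodic trial state** for `S ∈ C¹` lattice periodic
and Bose symmetric on a cell of side `L > 0` (positivity is automatic). [folklore] -/
theorem exists_trialState_exp_neg (hL : 0 < L) (hS : ContDiff ℝ 1 S) (hSper : IsLatticePeriodic L S)
    (hSsymm : ∀ (σ : Equiv.Perm (Fin N)) (X : Config N), S (X ∘ σ) = S X) :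
    ∃ (Ψ : PeriodicTrialState N L) (c : ℝ), 0 < c ∧
      ∀ X, Ψ.ψ X = (c : ℂ) * ((Real.exp (-S X) : ℝ) : ℂ) := by
  set F : Config N → ℂ := fun Y => ((Real.exp (-S Y) : ℝ) : ℂ) with hF
  have hC : ContDiff ℝ 1 F := contDiff_ofReal_exp_neg hS
  have hper : ∀ (X : Config N) (i : Fin N) (a : Fin 3),
      F (X + Pi.single i (EuclideanSpace.single a L)) = F X := isTorusPeriodic_ofReal_exp_neg hSper
  have hsymm : ∀ (σ : Equiv.Perm (Fin N)) (X : Config N), F (X ∘ σ) = F X := fun σ X => by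
    simp only [hF, hSsymm σ X]
  have h0 : ∫⁻ X in cellN N L, (‖F X‖₊ : ℝ≥0∞) ^ 2 ≠ 0 := by
    refine (lintegral_cellN_pos hC.continuous
      (X₀ := fun _ => (WithLp.toLp 2 fun _ => L / 2 : Space)) (fun i a => ?_) ?_).ne'
    · simp only [Set.mem_Ioo]
      constructor <;> linarith
    · simp only [hF, ne_eq, Complex.ofReal_eq_zero]
      exact (Real.exp_pos _).ne'
  have htop : ∫⁻ X in cellN N L, (‖F X‖₊ : ℝ≥0∞) ^ 2 ≠ ⊤ := by
    rw [lintegral_nnnorm_sq_eq_ofReal hC.continuous]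
    exact ENNReal.ofReal_ne_top
  refine ⟨PeriodicTrialState.ofFun F hC hper hsymm h0 htop,
    (Real.sqrt (∫⁻ X in cellN N L, (‖F X‖₊ : ℝ≥0∞) ^ 2).toReal)⁻¹,
    inv_pos.2 (Real.sqrt_pos.2 (ENNReal.toReal_pos h0 htop)), fun X => ?_⟩
  rw [PeriodicTrialState.ofFun_apply, Complex.ofReal_inv]

/-- Consequently the ground-state energy is at most the mean local energy of `e^{-S}`:
`E₀^per(N, L) ≤ ⟨E_loc⟩_{e^{-S}}` (Rayleigh–Ritz for the positive trial function `e^{-S}`,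
`S ∈ C²` lattice periodic and Bose symmetric). [folklore] -/
theorem periodicGroundStateEnergy_le_weightedMean (hL : 0 < L) (hvm : Measurable v) (hCw : Cw ≠ ⊤)
    (hW : ∀ X : Config N, periodicInteraction v L X ≤ Cw) (hS : ContDiff ℝ 2 S)
    (hSper : IsLatticePeriodic L S) (hSsymm : ∀ (σ : Equiv.Perm (Fin N)) (X : Config N), S (X ∘ σ) = S X) :
    periodicGroundStateEnergy v N L ≤ ENNReal.ofReal (weightedMean L (fun X => Real.exp (-S X))
      (fun X => localKinetic S X + (periodicInteraction v L X).toReal)) := by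
  obtain ⟨Ψ, c, -, hΨ⟩ := exists_trialState_exp_neg hL (hS.of_le (by norm_num)) hSper hSsymm
  rw [← periodicEnergy_eq_weightedMean hL hvm hCw hW hS hSper Ψ c hΨ]
  exact periodicGroundStateEnergy_le v Ψ

end ExpNeg

/-! ### Barta's inequality on the torus -/

section Barta

variable {S : Config N → ℝ}

/-- **Barta's inequality on the torus, a.e. form.** If the local energy `E_loc = ΔS - |∇S|² + W` of
the positive function `e^{-S}` (`S ∈ C²` lattice periodic; `W = ∑_{i<j} v^per` bounded) is `≥ m`
almost everywhere on the fundamental cell, then `m ≤ E₀^per(N, L)`: for every admissible `Ψ`,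
`⟨Ψ, HΨ⟩ = ∫ |∇Ψ|² + W|Ψ|² ≥ ∫ E_loc |Ψ|² ≥ m` by the ground-state representation
`integral_sum_norm_sq_covDeriv`. (No symmetry of `S` is needed for the lower bound.) [folklore] -/
theorem ofReal_le_periodicGroundStateEnergy_ae (hL : 0 < L) (hvm : Measurable v) (hCw : Cw ≠ ⊤)
    (hW : ∀ X : Config N, periodicInteraction v L X ≤ Cw) (hS : ContDiff ℝ 2 S)
    (hSper : IsLatticePeriodic L S) {m : ℝ}
    (hm : ∀ᵐ X ∂(volume.restrict (cellN N L)), m ≤ localKinetic S X + (periodicInteraction v L X).toReal) :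
    ENNReal.ofReal m ≤ periodicGroundStateEnergy v N L := by
  refine le_iInf fun Ψ => ?_
  rw [periodicEnergy, periodicForm_eq_ofReal hvm hCw hW Ψ.contDiff]
  refine ENNReal.ofReal_le_ofReal ?_
  have hS1 : ContDiff ℝ 1 S := hS.of_le (by norm_num)
  have hn : Continuous fun X => ‖Ψ.ψ X‖ ^ 2 := (Ψ.contDiff.continuous.norm).pow 2
  have hlk : Continuous (localKinetic S) :=
    (continuous_finsetSum _ fun i _ => continuous_finsetSum _ fun a _ =>
      continuous_pderiv (contDiff_one_pderiv hS i a) i a).sub (continuous_gradDot hS1 hS1)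
  -- integrability
  have hi_kin : IntegrableOn (fun X => kineticDensityReal Ψ.ψ X) (cellN N L) volume :=
    integrableOn_cellN (continuous_kineticDensityReal Ψ.contDiff) L
  have hi_W : IntegrableOn (fun X => (periodicInteraction v L X).toReal * ‖Ψ.ψ X‖ ^ 2) (cellN N L)
      volume := integrableOn_toReal_interaction_mul hvm hCw hW hn
  have hi_lk : IntegrableOn (fun X => localKinetic S X * ‖Ψ.ψ X‖ ^ 2) (cellN N L) volume :=
    integrableOn_cellN (hlk.mul hn) L
  have hi_m : IntegrableOn (fun X => m * ‖Ψ.ψ X‖ ^ 2) (cellN N L) volume :=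
    integrableOn_cellN (continuous_const.mul hn) L
  have hi_lkW : IntegrableOn (fun X => localKinetic S X * ‖Ψ.ψ X‖ ^ 2 +
      (periodicInteraction v L X).toReal * ‖Ψ.ψ X‖ ^ 2) (cellN N L) volume := hi_lk.add hi_W
  -- the ground-state representation gives `∫ |∇Ψ|² ≥ ∫ (ΔS - |∇S|²)|Ψ|²`
  have hgs := integral_sum_norm_sq_covDeriv hL hS hSper Ψ.contDiff Ψ.periodic
  have hnn : 0 ≤ ∫ X in cellN N L, (∑ i : Fin N, ∑ a : Fin 3,
      ‖fderiv ℝ Ψ.ψ X 𝐞[i, a] + Ψ.ψ X * (pderiv i a S X : ℂ)‖ ^ 2) :=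
    integral_nonneg fun X => Finset.sum_nonneg fun i _ => Finset.sum_nonneg fun a _ => sq_nonneg _
  have hmass1 : ∫ X in cellN N L, ‖Ψ.ψ X‖ ^ 2 = 1 := by
    have h := Ψ.norm_eq
    rw [lintegral_nnnorm_sq_eq_ofReal Ψ.contDiff.continuous] at h
    have h2 := ENNReal.toReal_ofReal (integral_nonneg fun X => sq_nonneg ‖Ψ.ψ X‖ :
      0 ≤ ∫ X in cellN N L, ‖Ψ.ψ X‖ ^ 2)
    rw [h, ENNReal.toReal_one] at h2
    exact h2.symm
  calc m = ∫ X in cellN N L, m * ‖Ψ.ψ X‖ ^ 2 := by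
        rw [integral_const_mul, hmass1, mul_one]
    _ ≤ ∫ X in cellN N L, (localKinetic S X * ‖Ψ.ψ X‖ ^ 2 +
          (periodicInteraction v L X).toReal * ‖Ψ.ψ X‖ ^ 2) := by
        refine integral_mono_ae hi_m hi_lkW (hm.mono fun X hX => ?_)
        nlinarith [sq_nonneg ‖Ψ.ψ X‖]
    _ = (∫ X in cellN N L, localKinetic S X * ‖Ψ.ψ X‖ ^ 2) +
          ∫ X in cellN N L, (periodicInteraction v L X).toReal * ‖Ψ.ψ X‖ ^ 2 :=
        integral_add hi_lk hi_W
    _ ≤ (∫ X in cellN N L, kineticDensityReal Ψ.ψ X) +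
          ∫ X in cellN N L, (periodicInteraction v L X).toReal * ‖Ψ.ψ X‖ ^ 2 := by linarith
    _ = ∫ X in cellN N L, (kineticDensityReal Ψ.ψ X +
          (periodicInteraction v L X).toReal * ‖Ψ.ψ X‖ ^ 2) := (integral_add hi_kin hi_W).symm

/-- **Barta's inequality on the torus.** If the local energy `E_loc = ΔS - |∇S|² + W` of the positive
function `e^{-S}` is bounded below by `m` on the fundamental cell, then `m ≤ E₀^per(N, L)` (pointwise
form of `ofReal_le_periodicGroundStateEnergy_ae`). [folklore] -/
theorem ofReal_le_periodicGroundStateEnergy (hL : 0 < L) (hvm : Measurable v) (hCw : Cw ≠ ⊤)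
    (hW : ∀ X : Config N, periodicInteraction v L X ≤ Cw) (hS : ContDiff ℝ 2 S)
    (hSper : IsLatticePeriodic L S) {m : ℝ}
    (hm : ∀ X ∈ cellN N L, m ≤ localKinetic S X + (periodicInteraction v L X).toReal) :
    ENNReal.ofReal m ≤ periodicGroundStateEnergy v N L :=
  ofReal_le_periodicGroundStateEnergy_ae hL hvm hCw hW hS hSper
    ((ae_restrict_mem (measurableSet_cellN N L)).mono hm)

/-- **A positive solution of the Schrödinger equation is a ground state (energy form).** If
`E_loc = ΔS - |∇S|² + W ≡ E` on the fundamental cell for `S ∈ C²` lattice periodic and Bose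
symmetric (`e^{-S}` solves `(-Δ + W) e^{-S} = E e^{-S}` there), then `E₀^per(N, L) = E`
(Barta from below, Rayleigh–Ritz from above; `E ≥ 0`). [folklore] -/
theorem periodicGroundStateEnergy_eq_of_localEnergy_eq (hL : 0 < L) (hvm : Measurable v)
    (hCw : Cw ≠ ⊤) (hW : ∀ X : Config N, periodicInteraction v L X ≤ Cw) (hS : ContDiff ℝ 2 S)
    (hSper : IsLatticePeriodic L S) (hSsymm : ∀ (σ : Equiv.Perm (Fin N)) (X : Config N), S (X ∘ σ) = S X)
    {E : ℝ} (hE : ∀ X ∈ cellN N L, localKinetic S X + (periodicInteraction v L X).toReal = E) :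
    periodicGroundStateEnergy v N L = ENNReal.ofReal E := by
  refine le_antisymm ?_ (ofReal_le_periodicGroundStateEnergy hL hvm hCw hW hS hSper fun X hX =>
    (hE X hX).ge)
  refine (periodicGroundStateEnergy_le_weightedMean hL hvm hCw hW hS hSper hSsymm).trans (le_of_eq ?_)
  congr 1
  rw [weightedMean]
  have hZ : (∫ X in cellN N L, Real.exp (-S X) ^ 2) ≠ 0 :=
    (integral_exp_neg_sq_pos hL hS.continuous).ne'
  rw [div_eq_iff hZ, ← integral_const_mul]
  refine setIntegral_congr_fun (measurableSet_cellN N L) fun X hX => ?_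
  rw [hE X hX]

end Barta

end PolicyImprovement

end Summit.AtomisticToContinuum.BoseEinsteinCondensation.Theorems

end
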